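import Mathlib.NumberTheory.ArithmeticFunction.Moebius
import Mathlib.Analysis.SpecialFunctions.Pow.Complex
import Mathlib.MeasureTheory.Integral.IntervalIntegral.Basic
import HarnessLib

/-!
# Route `PrimeLevelFamEdge` — TYPED IDEA DELTAS, deck 27: the SHORT-WINDOW FUNDER CANDIDATE for U ≡ L5′ of K_B
# (cell ls-idea, D-0159 U-WAVE; critic B = `ls-idea-ref-2` g7, precision P-B203-1 (card-verdicts b203/b205); the
# critic's `HOME/ls-idea-ref-2/r33/PB2031_Sketch.lean` sha16 438d26a4ae4f3776 (72 l., namespace `RefB.PB2031`,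
# ONE declared `sorry` on the implication); desk ls-idea-plan g4 U-WAVE AMENDMENT 1 booked it as «P-B203-1 =
# CANDIDATE FUNDER OF U ≡ L5′ AT FIXED PRIME LEVEL, pair (c)×(a′)» and opened DISPUTE D-L5′-1 «is U ≡ L5′
# fundable at fixed prime level?» for the K_B line lead `ls-Bfam-prover-1`; LANDING NOTE typer ls-idea-typ-1 gen 4:
# the five `def`s VERBATIM up to namespace `RefB.PB2031` → `…Theorems.PrimeLevelFamEdgeIdeaDeltas.ShortWindow`;
# the sorried `statement_of_gallagher` is NOT landed — its content is the `Prop` `StatementOfGallagher` (claimed,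
# never asserted); two bookkeeping lemmas proved.)

HONESTY. No exceptional-zero theorem (no Landau–Siegel / Siegel-zero exclusion, no Theorem 1–2 of
arXiv:2211.02515, no repaired Margin232) is proved here or by ideation; a lemma-candidate is a pointer to check,
not a bound; nothing below bounds any dual term of `stub_offDiagBelowSlack_io` (K_B = stmt-Parity-20343); typed ≠
proved; pencil ≠ kernel.  Every `def` below is a `Prop` SCHEMA or a real number; the two theorems are bookkeeping.

CONTENT (critic B's text).  Gallagher's lemma for Dirichlet polynomials × short-interval cancellation of the
coefficients ⇒ diagonal-sized mean square of `∑_{l≤M} a_l l^{-1/2-it}` on a SHORT window `|t| ≤ F`: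
`∫_{-F}^{F} |∑_{l≤M} a_l l^{-1/2-it}|² dt ≪ F·∑ a_l²/l + F^{1/(1-θ)+ε} + M (log M)^{-A}`.
Abstract in the coefficients `a`; the K_B instance is `a_l = x_l = μ(l)·P(log(M/l)/log M)`, for which
`ShortIntervalSaving a (7/12+δ) A` (every `δ > 0`, every `A`) is the Motohashi 1976 / Ramachandra 1976
short-interval Möbius asymptotic (`H ≥ x^θ`, every `θ > 7/12`; located by B in Matomäki–Teräväinen, JEMS 2022 =
arXiv:1911.09076, p. 3 L3–11) with the log-power saving of the Heath-Brown-identity route, plus partial summation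
over the smooth weight — PRINT INPUT TO BE VENDORED when critic C places the page (Ramachandra 1976 Acta Arith. 31 /
Heath-Brown 1982 not opened; hence `MobiusShortIntervals` is an UNCITED hypothesis shape here, not a Literature
fact).  `GallagherDirichlet` = Gallagher 1970 Lemma 1 (Montgomery 1971 LNM 227 Lemma 1.9) in MULTIPLICATIVE form
(frequencies `log n`, window `(y, e^{1/T}y]`, `∃ C`); the tree holds only the integer-frequency form as the NAMED FACT
`Literature.NumberTheory.Sieve.MontgomeryVaughan1975.lemma42_gallagher` — a kernel proof of both forms (triangle
kernel, Fourier inversion, Jordan's inequality) is the typer's next file; until it lands `GallagherDirichlet` is a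
hypothesis.  B's numerics (ms_check_B.py 78dd54ec88438d3b): the (c)×(a′) `t`-integral is DIAGONAL-SIZED at
`M = 6953 / 14533` (ratio 0.8–1.03 to `2F·Σ x_l²/l`); usefulness window `F ≤ M^{5/12−ε}` ⟺ `η < 5/31`, no
restriction for K_B as typed (`∃ b > 1, ∀ Δ′ ∈ (1, b)`).  What would remain load-bearing after this funder is
ARCHIMEDEAN (desk amendment 1): (α) uniform stationary phase for the `J₁`-weighted smooth `r`-sum, (β) Mellin-kernel
`t`-flatness — tasks U-13 / U-20, outside this file.
-/

noncomputable section

open scoped Real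
open Finset MeasureTheory Complex

namespace Summit.Parity.GeneralizedHardyLittlewood.Theorems.PrimeLevelFamEdgeIdeaDeltas.ShortWindow


/-- Short-interval cancellation with a log-power saving: `|∑_{y<n≤y+h} a n| ≤ C·h·(log y)^{-A}`
for `y ≥ y₀` and `y^θ ≤ h ≤ y`. -/
def ShortIntervalSaving (a : ℕ → ℝ) (θ A : ℝ) : Prop :=
  ∃ C y₀ : ℝ, ∀ y h : ℝ, y₀ ≤ y → y ^ θ ≤ h → h ≤ y →
    |∑ n ∈ (Icc 1 (⌊2 * y⌋₊ + 1)).filter (fun n : ℕ => y < (n : ℝ) ∧ (n : ℝ) ≤ y + h), a n|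
      ≤ C * h * (Real.log y) ^ (-A)

/-- Gallagher's lemma (Gallagher 1970, Lemma 1; Montgomery 1971, LNM 227, Lemma 1.10) in the
Dirichlet-polynomial form (frequencies `log n`): for `T ≥ 1`,
`∫_{-T}^{T} |∑_{n≤N} a_n n^{-it}|² dt ≤ C·T²·∫_0^∞ |∑_{y<n≤e^{1/T} y} a_n|² dy/y`.
(The tree's `Literature.NumberTheory.Sieve.MontgomeryVaughan1975.lemma42_gallagher` is the
integer-frequency form with `e(nη)`; this multiplicative form is not in the tree.) -/
def GallagherDirichlet : Prop :=
  ∃ C : ℝ, ∀ (N : ℕ) (a : ℕ → ℂ) (T : ℝ), 1 ≤ T →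
    ∫ t in (-T)..T, ‖∑ n ∈ Icc 1 N, a n * (n : ℂ) ^ (-((t : ℂ) * I))‖ ^ 2 ≤
      C * T ^ 2 * ∫ y in Set.Ioi (0 : ℝ),
        ‖∑ n ∈ (Icc 1 N).filter (fun n : ℕ => y < (n : ℝ) ∧ (n : ℝ) ≤ Real.exp (1 / T) * y),
          a n‖ ^ 2 / y

/-- The short-window mean square of the `σ = 1/2` Dirichlet polynomial with real coefficients `a`,
length `M`, window `|t| ≤ F`. -/
noncomputable def shortWindowMeanSquare (a : ℕ → ℝ) (M : ℕ) (F : ℝ) : ℝ :=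
  ∫ t in (-F)..F, ‖∑ l ∈ Icc 1 M, (a l : ℂ) * (l : ℂ) ^ (-(1 / 2 : ℂ) - (t : ℂ) * I)‖ ^ 2

/-- **P-B203-1 (abstract form).** For coefficients `|a n| ≤ 1` with short-interval saving at
exponent `θ` for every log power, the mean square on `|t| ≤ F` (any `F ≥ 2`, any `M ≥ M₀`) is
`≤ C·(F·∑_{l≤M} a_l²/l + F^{1/(1-θ)+ε} + M·(log M)^{-A})`: diagonal + trivial range + saving.
Useful (= `o(M)`) exactly when `F^{1/(1-θ)} ≤ M^{1-ε'}`, i.e. `F ≤ M^{5/12-ε''}` at `θ = 7/12`. -/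
def Statement (θ : ℝ) : Prop :=
  ∀ (a : ℕ → ℝ), (∀ n, |a n| ≤ 1) → (∀ A : ℝ, ShortIntervalSaving a θ A) →
    ∀ ε A : ℝ, 0 < ε → ∃ C : ℝ, ∃ M₀ : ℕ, ∀ M : ℕ, M₀ ≤ M → ∀ F : ℝ, 2 ≤ F →
      shortWindowMeanSquare a M F ≤
        C * (F * ∑ l ∈ Icc 1 M, a l ^ 2 / (l : ℝ) + F ^ (1 / (1 - θ) + ε)
          + (M : ℝ) * (Real.log (M : ℝ)) ^ (-A))

/-- CLAIMED IMPLICATION (critic B's pencil, card-verdicts b203 (C1); the seat's sketch carries it as a sorried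
`theorem statement_of_gallagher` — NOT landed; typed here as a `Prop`, never asserted): Gallagher's lemma funds the
short-window statement at every exponent `θ ∈ [1/2, 1)` — split the `y`-integral of `GallagherDirichlet` at `y ≤ F`
(diagonal), `F < y ≤ F^{1/(1-θ)+ε}` (trivial bound on the window sum), `y > F^{1/(1-θ)+ε}` (the saving, by partial
summation of `n^{-1/2}`). -/
def StatementOfGallagher : Prop :=
  GallagherDirichlet → ∀ θ : ℝ, 1 / 2 ≤ θ → θ < 1 → Statement θ

/-- The Möbius input at Huxley's exponent (Motohashi 1976; Ramachandra 1976; log-power saving via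
Heath-Brown's identity), as a hypothesis to be vendored from print, not proved. -/
def MobiusShortIntervals : Prop :=
  ∀ δ A : ℝ, 0 < δ →
    ShortIntervalSaving (fun n => (ArithmeticFunction.moebius n : ℝ)) (7 / 12 + δ) A

/-! ## Bookkeeping (PROVED) -/

/-- The short-window mean square is non-negative for `0 ≤ F` (an interval integral of a square over `[-F, F]`). -/
theorem shortWindowMeanSquare_nonneg (a : ℕ → ℝ) (M : ℕ) {F : ℝ} (hF : 0 ≤ F) :
    0 ≤ shortWindowMeanSquare a M F := by
  unfold shortWindowMeanSquare
  exact intervalIntegral.integral_nonneg (by linarith) fun t _ => by positivity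

/-- A short-interval saving with a log power `A` gives every smaller log power `A' ≤ A` (raise the threshold to
`y ≥ exp 1`, where `(log y)^{-A} ≤ (log y)^{-A'}`). -/
theorem ShortIntervalSaving.mono {a : ℕ → ℝ} {θ A A' : ℝ} (h : ShortIntervalSaving a θ A) (hA : A' ≤ A) :
    ShortIntervalSaving a θ A' := by
  obtain ⟨C, y₀, hC⟩ := h
  refine ⟨max C 0, max y₀ (Real.exp 1), fun y hh hy₀ hθ hhy => ?_⟩
  have hy₁ : Real.exp 1 ≤ y := le_trans (le_max_right _ _) hy₀
  have hlog : 1 ≤ Real.log y := by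
    rw [← Real.log_exp 1]; exact Real.log_le_log (Real.exp_pos 1) hy₁
  have hypos : 0 < y := lt_of_lt_of_le (Real.exp_pos 1) hy₁
  have hθpos : 0 < y ^ θ := Real.rpow_pos_of_pos hypos θ
  have hhpos : 0 ≤ hh := le_trans hθpos.le hθ
  have h1 := hC y hh (le_trans (le_max_left _ _) hy₀) hθ hhy
  have hlog0 : 0 ≤ Real.log y := by linarith
  have hpowA : 0 ≤ Real.log y ^ (-A) := Real.rpow_nonneg hlog0 _
  have hpow : Real.log y ^ (-A) ≤ Real.log y ^ (-A') :=
    Real.rpow_le_rpow_of_exponent_le hlog (by linarith)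
  calc |∑ n ∈ (Icc 1 (⌊2 * y⌋₊ + 1)).filter (fun n : ℕ => y < (n : ℝ) ∧ (n : ℝ) ≤ y + hh), a n|
      ≤ C * hh * Real.log y ^ (-A) := h1
    _ ≤ max C 0 * hh * Real.log y ^ (-A) :=
        mul_le_mul_of_nonneg_right (mul_le_mul_of_nonneg_right (le_max_left _ _) hhpos) hpowA
    _ ≤ max C 0 * hh * Real.log y ^ (-A') :=
        mul_le_mul_of_nonneg_left hpow (mul_nonneg (le_max_right _ _) hhpos)

end Summit.Parity.GeneralizedHardyLittlewood.Theorems.PrimeLevelFamEdgeIdeaDeltas.ShortWindow
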